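import Literature.NumberTheory.EllipticCurves.KellerYin2024.CharacterSelmerGroups
import Literature.NumberTheory.EllipticCurves.Kato2004.SemilocalDecompositionProofs
import HarnessLib

/-!
# Keller–Yin §0.2 / §1.4: the TEICHMÜLLER CHARACTERS `ω̃`, `𝟙̃` of the good lattice — the character
# by which `Γ_K` acts on a stable cyclic subquotient of prime order `p`, lifted to `𝓞ˣ` — as
# rank-one framed Galois representations (DEFINITIONS, a CONSTRUCTION, and its proved specification)

Cell `bsd-eis` (FULL-BSD rank ≤ 1 programme, home `run/shared/lean/pub/bsd-eis/`), seat
`bsd-eis-k5-c2` (D-0074 group (C) row A; crux 2 `GoodLatticeBDPValue`, stub `stub_muLambda`). The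
Literature statements of Keller–Yin Thm. 1.5.1 (`algmain`), Thm. 2.2.2 (`anacong`) and of the
one-variable character main conjectures (Thm. 1.2.2 / proof of Thm. 2.2.3) are statements about the
two CHARACTERS `φ = ω̃` and `ψ = 𝟙̃` of `Γ_K` attached to the lattice `T_f`:

> "By Ribet's Lemma, from the decomposition `ρ̄_f^{ss} ≅ 𝔽(φ) ⊕ 𝔽(ψ)` one has an exact sequence
> `0 → 𝔽(φ) → ρ̄_f → 𝔽(ψ) → 0` … From now on, by essentially choosing a lattice `T_f`, we fix the
> following ordering of the characters … `0 → M_{ω̃}[𝔭] → M_f[𝔭] → M_{𝟙̃}[𝔭] → 0`."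
> (arXiv:2402.12781v2, §1.4, TeX L1063–1086); "Via the Teichmüller lift `𝔽^× ↪ F^×`, we shall also
> view `θ` as taking values in `𝓞^×`" (§1.1, L441).

For an elliptic curve `E/ℚ` (the programme's row A1) `𝔽 = 𝔽_p`, `𝓞 = ℤ_p`: `φ̄` is the character by
which `Γ_K` acts on the `Γ_K`-stable line `Φ ≤ E[p]`, `ψ̄` the character on `E[p]/Φ`, and `ω̃`, `𝟙̃`
their Teichmüller lifts `Γ_K → μ_{p−1} ⊂ ℤ_p^× ⊂ 𝓞^×`. This file supplies these objects in the tree's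
rank-one currency `FramedGaloisRep K (padicCoeffIntegers S) 1` (the coefficient ring of
`CharacterSelmerGroups.lean` §3, so that `charModule S θ = (F/𝓞)(θ)` and the dual data
`unrDualData` / `grDualData` apply verbatim):

* §1 `quotActionChar` — for a group `G` acting on an additive group `M` and `G`-stable subgroups
  `N ≤ T ≤ M` with `[T : N] = p`: the character `G →* (ℤ/p)ˣ` by which `G` acts on the cyclic group
  `T/N` of order `p`, with its specification `smul_sub_zsmul_mem` (`σ • P − a(σ) • P ∈ N` for
  `P ∈ T`); §2 `IsTeichmullerLiftOnQuot S N T θ` — the PREDICATE "`θ : Γ_K → GL₁(𝓞)` is `(p−1)`-torsion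
  and reduces to the action of `Γ_K` on `T/N`" (`N = ⊥`: on `T` itself, `IsTeichmullerLiftOn`), which is
  how the typed statements quantify over `ω̃`, `𝟙̃`; §3 the CONSTRUCTION `teichmullerLiftOnQuot`
  (`quotActionChar` ∘ the tree's `Kato2004.teichmullerChar` ∘ `ℤ_p → 𝓞`, continuous because the
  stabilisers of the finitely many points of `T` are open) and `isTeichmullerLiftOnQuot_teichmullerLiftOnQuot`;
  §4 the push-forward `toPadicAlgCl θ : FramedGaloisRep K ℚ̄_p 1` along `𝓞 ⊂ ℚ̄_p` (the shape in which
  the analytic side reads `θ` as the `p`-adic avatar of a finite-order Hecke character,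
  `IsPAdicAvatarOf`).

DEFINITIONS AND PROVED LEMMAS ONLY (D-0026): no named fact, nothing about any curve asserted.

## References
* [KellerYin2024] §1.1 (L438–449), §1.4 (L1063–1086), Prop. 1.3.1 (`omega first non-split`).
* [CastellaGrossiLeeSkinner2022] §1.3–1.4 (`E[p]^{ss} = 𝔽_p(φ) ⊕ 𝔽_p(ψ)`).
* [LangCyclotomic1990] Ch. 1 §2 (Teichmüller character).
-/

noncomputable section

open scoped Classical

open NumberField Field
open Literature.NumberTheory.EllipticCurves Literature.NumberTheory.GaloisRepresentations

namespace Literature.NumberTheory.EllipticCurves.KellerYin2024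

/-! ## §1 The character of a group on a stable cyclic subquotient of prime order -/

section ActionChar

variable {G : Type*} [Group G] {M : Type*} [AddCommGroup M] [DistribMulAction G M]
  {p : ℕ} [hp : Fact p.Prime] {N T : AddSubgroup M}

/-- The class of `P ∈ T` in `T/N` (through `N.addSubgroupOf T`). Plumbing. [folklore] -/
private def cls (N T : AddSubgroup M) (P : T) : T ⧸ N.addSubgroupOf T := (P : T ⧸ N.addSubgroupOf T)

omit hp in
/-- Two elements of `T` have the same class in `T/N` iff their difference lies in `N`. [folklore] -/
private theorem cls_eq_cls_iff (P Q : T) : cls N T P = cls N T Q ↔ (P : M) - Q ∈ N := by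
  rw [cls, cls, QuotientAddGroup.eq, AddSubgroup.mem_addSubgroupOf, AddSubgroup.coe_add,
    AddSubgroup.coe_neg, neg_add_eq_sub, ← neg_sub, neg_mem_iff]

omit hp in
/-- `cls` is compatible with integer multiples (it is the quotient map). [folklore] -/
private theorem cls_zsmul (n : ℤ) (P : T) : cls N T (n • P) = n • cls N T P := rfl

/-- `T/N` is cyclic of order `p` when `[T : N] = p`: there is `Q₀ ∈ T` whose class generates.
[folklore] -/
private theorem exists_generator (hidx : N.relIndex T = p) :
    ∃ Q : T, ∀ x : T ⧸ N.addSubgroupOf T, x ∈ AddSubgroup.zmultiples (cls N T Q) := by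
  have hcard : Nat.card (T ⧸ N.addSubgroupOf T) = p := by
    rw [← AddSubgroup.index_eq_card]; exact hidx
  haveI : IsAddCyclic (T ⧸ N.addSubgroupOf T) := isAddCyclic_of_prime_card hcard
  obtain ⟨q, hq⟩ := IsAddCyclic.exists_generator (α := T ⧸ N.addSubgroupOf T)
  obtain ⟨Q, rfl⟩ := QuotientAddGroup.mk_surjective q
  exact ⟨Q, hq⟩

/-- A chosen `Q₀ ∈ T` whose class generates `T/N`. [folklore] -/
private def gen (hidx : N.relIndex T = p) : T := Classical.choose (exists_generator hidx)

/-- The class of `gen` generates `T/N`. [folklore] -/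
private theorem gen_spec (hidx : N.relIndex T = p) (x : T ⧸ N.addSubgroupOf T) :
    x ∈ AddSubgroup.zmultiples (cls N T (gen hidx)) :=
  Classical.choose_spec (exists_generator hidx) x

omit hp in
/-- `p • P ∈ N` for `P ∈ T` (`T/N` has order `p`). [folklore] -/
private theorem prime_zsmul_mem (hidx : N.relIndex T = p) (P : T) : (p : ℤ) • (P : M) ∈ N := by
  have hcard : Nat.card (T ⧸ N.addSubgroupOf T) = p := by
    rw [← AddSubgroup.index_eq_card]; exact hidx
  have h : (p : ℤ) • cls N T P = cls N T 0 := by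
    rw [natCast_zsmul, ← hcard, card_nsmul_eq_zero']; rfl
  rw [← cls_zsmul, cls_eq_cls_iff] at h
  simpa using h

/-- Integers congruent mod `p` act the same way on `T` modulo `N`. [folklore] -/
private theorem zsmul_sub_zsmul_mem_of_intCast_eq (hidx : N.relIndex T = p) {a b : ℤ}
    (hab : (a : ZMod p) = (b : ZMod p)) (P : T) : a • (P : M) - b • (P : M) ∈ N := by
  obtain ⟨c, hc⟩ := (ZMod.intCast_eq_intCast_iff_dvd_sub b a p).mp hab.symm
  have : a • (P : M) - b • (P : M) = c • ((p : ℤ) • (P : M)) := by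
    rw [← sub_smul, hc, mul_comm, mul_smul]
  rw [this]
  exact N.zsmul_mem (prime_zsmul_mem hidx P) c

/-- The generator is not in `N` (else `T/N = 0`, contradicting `#(T/N) = p > 1`). [folklore] -/
private theorem gen_notMem (hidx : N.relIndex T = p) : ((gen hidx : T) : M) ∉ N := by
  intro h
  have hcard : Nat.card (T ⧸ N.addSubgroupOf T) = p := by
    rw [← AddSubgroup.index_eq_card]; exact hidx
  have h0 : cls N T (gen hidx) = cls N T 0 := by
    rw [cls_eq_cls_iff]; simpa using h
  have hsub : Subsingleton (T ⧸ N.addSubgroupOf T) := by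
    refine ⟨fun x y ↦ ?_⟩
    obtain ⟨a, ha⟩ := AddSubgroup.mem_zmultiples_iff.mp (gen_spec hidx x)
    obtain ⟨b, hb⟩ := AddSubgroup.mem_zmultiples_iff.mp (gen_spec hidx y)
    rw [← ha, ← hb, h0]
    change a • ((0 : T) : T ⧸ N.addSubgroupOf T) = b • ((0 : T) : T ⧸ N.addSubgroupOf T)
    rw [QuotientAddGroup.mk_zero, smul_zero, smul_zero]
  have h1 : Nat.card (T ⧸ N.addSubgroupOf T) = 1 :=
    Nat.card_eq_one_iff_unique.mpr ⟨hsub, ⟨cls N T 0⟩⟩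
  have hp1 := hp.out.one_lt
  omega

variable (hN : ∀ g : G, ∀ P ∈ N, g • P ∈ N) (hT : ∀ g : G, ∀ P ∈ T, g • P ∈ T)
include hT

/-- For `σ ∈ G` there is an integer `k` with `σ • Q₀ − k • Q₀ ∈ N` (`T/N` is generated by the class
of `Q₀`). [folklore] -/
private theorem exists_smul_gen_sub_zsmul_mem (hidx : N.relIndex T = p) (σ : G) :
    ∃ k : ℤ, σ • ((gen hidx : T) : M) - k • ((gen hidx : T) : M) ∈ N := by
  obtain ⟨k, hk⟩ := AddSubgroup.mem_zmultiples_iff.mp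
    (gen_spec hidx (cls N T ⟨σ • ((gen hidx : T) : M), hT σ _ (gen hidx).2⟩))
  refine ⟨k, ?_⟩
  rw [← cls_zsmul, eq_comm, cls_eq_cls_iff] at hk
  simpa using hk

/-- The scalar `a(σ) ∈ ℤ/p` by which `σ` acts on `T/N` (`σ • Q₀ ≡ a(σ) • Q₀ mod N`). [folklore] -/
private def scalar (hidx : N.relIndex T = p) (σ : G) : ZMod p :=
  ((Classical.choose (exists_smul_gen_sub_zsmul_mem hT hidx σ) : ℤ) : ZMod p)

include hN

/-- **Specification of the scalar**: for every `P ∈ T` and every integer `a ≡ a(σ) (mod p)`,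
`σ • P − a • P ∈ N`. [folklore] -/
private theorem smul_sub_zsmul_mem_of_intCast_eq_scalar (hidx : N.relIndex T = p) (σ : G) {a : ℤ}
    (ha : (a : ZMod p) = scalar hT hidx σ) (P : T) : σ • (P : M) - a • (P : M) ∈ N := by
  obtain ⟨n, hn⟩ := AddSubgroup.mem_zmultiples_iff.mp (gen_spec hidx (cls N T P))
  rw [← cls_zsmul, eq_comm, cls_eq_cls_iff] at hn
  -- `hn : P − n • Q₀ ∈ N`
  set Q : M := ((gen hidx : T) : M) with hQ
  have hnQ : (P : M) - n • Q ∈ N := by simpa using hn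
  set k : ℤ := Classical.choose (exists_smul_gen_sub_zsmul_mem hT hidx σ) with hk
  have hkQ : σ • Q - k • Q ∈ N := Classical.choose_spec (exists_smul_gen_sub_zsmul_mem hT hidx σ)
  have hak : a • (P : M) - k • (P : M) ∈ N :=
    zsmul_sub_zsmul_mem_of_intCast_eq hidx (by rw [ha]; rfl) P
  have h1 : σ • ((P : M) - n • Q) ∈ N := hN σ _ hnQ
  have h2 : n • (σ • Q - k • Q) ∈ N := N.zsmul_mem hkQ n
  have h3 : k • ((P : M) - n • Q) ∈ N := N.zsmul_mem hnQ k
  have key : σ • (P : M) - k • (P : M) =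
      σ • ((P : M) - n • Q) + n • (σ • Q - k • Q) + k • ((P : M) - n • Q) - k • (P : M) +
        (k • (P : M) - k • ((P : M) - n • Q) - k • ((P : M) - n • Q)) := by
    rw [smul_sub σ (P : M) (n • Q), smul_comm σ n Q, zsmul_sub, zsmul_sub, smul_comm n k Q]
    abel
  have key' : σ • (P : M) - k • (P : M) =
      σ • ((P : M) - n • Q) + n • (σ • Q - k • Q) - k • ((P : M) - n • Q) := by
    rw [smul_sub σ (P : M) (n • Q), smul_comm σ n Q, zsmul_sub, zsmul_sub, smul_comm n k Q]
    abel
  have h4 : σ • (P : M) - k • (P : M) ∈ N := by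
    rw [key']; exact N.sub_mem (N.add_mem h1 h2) h3
  have : σ • (P : M) - a • (P : M) = (σ • (P : M) - k • (P : M)) - (a • (P : M) - k • (P : M)) := by
    abel
  rw [this]
  exact N.sub_mem h4 hak

/-- In particular `σ • P − ã(σ) • P ∈ N` for the canonical lift `ã(σ) = (a(σ)).val`. [folklore] -/
private theorem smul_sub_val_scalar_zsmul_mem (hidx : N.relIndex T = p) (σ : G) (P : T) :
    σ • (P : M) - ((scalar hT hidx σ).val : ℤ) • (P : M) ∈ N :=
  smul_sub_zsmul_mem_of_intCast_eq_scalar hN hT hidx σ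
    (by rw [Int.cast_natCast, ZMod.natCast_zmod_val]) P

/-- **Uniqueness of the scalar**: if `σ • Q₀ − a • Q₀ ∈ N` then `a ≡ a(σ) (mod p)`. [folklore] -/
private theorem intCast_eq_scalar_of_smul_gen_sub_zsmul_mem (hidx : N.relIndex T = p) (σ : G) {a : ℤ}
    (ha : σ • ((gen hidx : T) : M) - a • ((gen hidx : T) : M) ∈ N) :
    (a : ZMod p) = scalar hT hidx σ := by
  by_contra hne
  -- `(a(σ) − a) • Q₀ ∈ N` with `a(σ) − a` a unit mod `p` forces `Q₀ ∈ N`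
  have h1 := smul_sub_val_scalar_zsmul_mem hN hT hidx σ (gen hidx)
  have h2 : (((scalar hT hidx σ).val : ℤ) - a) • ((gen hidx : T) : M) ∈ N := by
    have : (((scalar hT hidx σ).val : ℤ) - a) • ((gen hidx : T) : M) =
        (σ • ((gen hidx : T) : M) - a • ((gen hidx : T) : M)) -
          (σ • ((gen hidx : T) : M) - ((scalar hT hidx σ).val : ℤ) • ((gen hidx : T) : M)) := by
      rw [sub_smul]; abel
    rw [this]; exact N.sub_mem ha h1
  set d : ZMod p := ((scalar hT hidx σ).val : ZMod p) - (a : ZMod p) with hd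
  have hd0 : d ≠ 0 := by
    rw [hd, sub_ne_zero, ZMod.natCast_zmod_val]
    exact fun h ↦ hne h.symm
  -- an inverse `c` of `d` mod `p`
  obtain ⟨c, hc⟩ : ∃ c : ℤ, ((c : ZMod p) * d) = 1 :=
    ⟨((d⁻¹ : ZMod p).val : ℤ), by rw [Int.cast_natCast, ZMod.natCast_zmod_val, inv_mul_cancel₀ hd0]⟩
  have h3 : (c * (((scalar hT hidx σ).val : ℤ) - a)) • ((gen hidx : T) : M) ∈ N := by
    rw [mul_smul]; exact N.zsmul_mem h2 c
  have h4 : (1 : ℤ) • ((gen hidx : T) : M) - (c * (((scalar hT hidx σ).val : ℤ) - a)) •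
      ((gen hidx : T) : M) ∈ N :=
    zsmul_sub_zsmul_mem_of_intCast_eq hidx (by push_cast; rw [← hd, hc]) (gen hidx)
  have : ((gen hidx : T) : M) ∈ N := by
    have h5 := N.add_mem h4 h3
    rwa [sub_add_cancel, one_smul] at h5
  exact gen_notMem hidx this

/-- The scalar of `1` is `1`. [folklore] -/
private theorem scalar_one (hidx : N.relIndex T = p) : scalar hT hidx 1 = 1 := by
  have h := intCast_eq_scalar_of_smul_gen_sub_zsmul_mem hN hT hidx 1 (a := 1)
    (by rw [one_smul, one_smul, sub_self]; exact N.zero_mem)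
  rw [← h, Int.cast_one]

/-- The scalar is multiplicative. [folklore] -/
private theorem scalar_mul (hidx : N.relIndex T = p) (σ τ : G) :
    scalar hT hidx (σ * τ) = scalar hT hidx σ * scalar hT hidx τ := by
  set a : ℤ := ((scalar hT hidx σ).val : ℤ)
  set b : ℤ := ((scalar hT hidx τ).val : ℤ)
  have hτ := smul_sub_val_scalar_zsmul_mem hN hT hidx τ (gen hidx)
  have hσ := smul_sub_val_scalar_zsmul_mem hN hT hidx σ ⟨b • ((gen hidx : T) : M),
    T.zsmul_mem (gen hidx).2 b⟩
  -- `(στ) • Q₀ − (ab) • Q₀ = σ • (τQ₀ − bQ₀) + (σ(bQ₀) − a(bQ₀))`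
  have hmem : (σ * τ) • ((gen hidx : T) : M) - (a * b) • ((gen hidx : T) : M) ∈ N := by
    have e : (σ * τ) • ((gen hidx : T) : M) - (a * b) • ((gen hidx : T) : M) =
        σ • (τ • ((gen hidx : T) : M) - b • ((gen hidx : T) : M)) +
          (σ • (b • ((gen hidx : T) : M)) - a • (b • ((gen hidx : T) : M))) := by
      rw [mul_smul, smul_sub, mul_smul]; abel
    rw [e]
    exact N.add_mem (hN σ _ hτ) hσ
  have h := intCast_eq_scalar_of_smul_gen_sub_zsmul_mem hN hT hidx (σ * τ) hmem
  rw [← h, Int.cast_mul]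
  simp only [a, b, Int.cast_natCast, ZMod.natCast_zmod_val]

/-- The scalar is non-zero (`σ` is invertible on `T/N ≠ 0`). [folklore] -/
private theorem scalar_ne_zero (hidx : N.relIndex T = p) (σ : G) : scalar hT hidx σ ≠ 0 := by
  intro h0
  have h := scalar_mul hN hT hidx σ⁻¹ σ
  rw [inv_mul_cancel, scalar_one hN hT hidx, h0, mul_zero] at h
  exact one_ne_zero h

/-- **The character `a : G →* (ℤ/p)ˣ` of `G` on the cyclic subquotient `T/N` of order `p`.**
[cite: KellerYin2024, §1.4 (arXiv:2402.12781v2 TeX L1063–1086: the characters φ, ψ of ρ̄_f)] -/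
def quotActionChar (hidx : N.relIndex T = p) : G →* (ZMod p)ˣ where
  toFun σ := Units.mk0 (scalar hT hidx σ) (scalar_ne_zero hN hT hidx σ)
  map_one' := Units.ext (by rw [Units.val_mk0, Units.val_one, scalar_one hN hT hidx])
  map_mul' σ τ := Units.ext (by
    rw [Units.val_mk0, Units.val_mul, Units.val_mk0, Units.val_mk0, scalar_mul hN hT hidx])

/-- Unfolding `quotActionChar`. [folklore] -/
private theorem val_quotActionChar (hidx : N.relIndex T = p) (σ : G) :
    ((quotActionChar hN hT hidx σ : (ZMod p)ˣ) : ZMod p) = scalar hT hidx σ := rfl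

/-- **Specification**: `σ • P − a • P ∈ N` for every `P ∈ T` and every integer `a` reducing to
`quotActionChar σ`. [cite: KellerYin2024, §1.4 (arXiv:2402.12781v2 TeX L1063–1086)] -/
theorem smul_sub_zsmul_mem (hidx : N.relIndex T = p) (σ : G) {a : ℤ}
    (ha : (a : ZMod p) = ((quotActionChar hN hT hidx σ : (ZMod p)ˣ) : ZMod p)) {P : M} (hP : P ∈ T) :
    σ • P - a • P ∈ N :=
  smul_sub_zsmul_mem_of_intCast_eq_scalar hN hT hidx σ ha ⟨P, hP⟩

/-- The kernel of `quotActionChar` contains every `σ` fixing `T` pointwise. [cite: KellerYin2024, §1.4 (arXiv:2402.12781v2 TeX L1063–1086)] -/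
theorem quotActionChar_eq_one_of_forall_smul_eq (hidx : N.relIndex T = p) {σ : G}
    (hσ : ∀ P ∈ T, σ • P = P) : quotActionChar hN hT hidx σ = 1 := by
  apply Units.ext
  rw [val_quotActionChar, Units.val_one]
  have h := intCast_eq_scalar_of_smul_gen_sub_zsmul_mem hN hT hidx σ (a := 1)
    (by rw [hσ _ (gen hidx).2, one_smul, sub_self]; exact N.zero_mem)
  rw [← h, Int.cast_one]

end ActionChar


/-! ## §2 The predicates "`θ` is the Teichmüller lift of the action on `T/N`" -/

section Predicates

variable {K : Type} [Field K] {p : ℕ} [Fact p.Prime] (S : Set (PadicAlgCl p))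
  {M : Type*} [AddCommGroup M] [DistribMulAction (absoluteGaloisGroup K) M]

/-- The matrix entry `θ(σ) ∈ 𝓞` of a rank-one framed representation `θ : Γ_K → GL₁(𝓞)` (plumbing). [folklore] -/
def entry (θ : FramedGaloisRep K (padicCoeffIntegers S) 1) (σ : absoluteGaloisGroup K) :
    padicCoeffIntegers S :=
  ((θ σ : GL (Fin 1) (padicCoeffIntegers S)) : Matrix (Fin 1) (Fin 1) (padicCoeffIntegers S)) 0 0

/-- **`θ` is the TEICHMÜLLER LIFT of the character of `Γ_K` on the cyclic subquotient `T/N` of order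
`p`** (Keller–Yin §1.4 with §1.1 L441: `θ : G_K → 𝔽^×` "viewed as taking values in `𝓞^×` via the
Teichmüller lift"): `θ : Γ_K → GL₁(𝓞)`, `𝓞 = 𝓞_{ℚ_p(S)}`, is `(p − 1)`-torsion (its values are the
prime-to-`p` roots of unity of `ℤ_p ⊂ 𝓞`, the Teichmüller representatives) and for every `σ` there
is an integer `a ≡ θ(σ) (mod 𝔭)` with `σ • P ≡ a • P (mod N)` for all `P ∈ T`. With `N = Φ`,
`T = E[p]`: `θ = 𝟙̃` (the character `ψ` on `ρ̄_f/𝔽(φ)`); with `N = ⊥`, `T = Φ`: `θ = ω̃` (the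
character `φ` on the stable line), see `IsTeichmullerLiftOn`. A predicate; the construction
`teichmullerLiftOnQuot` below satisfies it. [cite: KellerYin2024, §1.4 (arXiv:2402.12781v2 TeX L1063–1086) and §1.1 (L441)] -/
def IsTeichmullerLiftOnQuot (N T : AddSubgroup M) (θ : FramedGaloisRep K (padicCoeffIntegers S) 1) :
    Prop :=
  (∀ σ : absoluteGaloisGroup K, θ σ ^ (p - 1) = 1) ∧
    ∀ σ : absoluteGaloisGroup K, ∃ a : ℤ,
      ‖((entry S θ σ : padicCoeffIntegers S) : PadicAlgCl p) - (a : PadicAlgCl p)‖ < 1 ∧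
        ∀ P ∈ T, σ • P - a • P ∈ N

/-- **`θ` is the Teichmüller lift of the character of `Γ_K` on the stable cyclic subgroup `Φ` of order
`p`** (`= IsTeichmullerLiftOnQuot S ⊥ Φ θ`: `σ • P = a • P` on `Φ` with `a ≡ θ(σ) (mod 𝔭)`): for the
good lattice, `θ = ω̃` = the character `φ` of `0 → 𝔽(φ) → ρ̄_f → 𝔽(ψ) → 0` Teichmüller-lifted.
[cite: KellerYin2024, §1.4 (arXiv:2402.12781v2 TeX L1063–1086) and §1.1 (L441)] -/
abbrev IsTeichmullerLiftOn (Φ : AddSubgroup M) (θ : FramedGaloisRep K (padicCoeffIntegers S) 1) :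
    Prop :=
  IsTeichmullerLiftOnQuot S ⊥ Φ θ

variable {S}

/-- Reading `IsTeichmullerLiftOn`: on `Φ` the action IS scalar, `σ • P = a • P`. [cite: KellerYin2024, §1.4 (arXiv:2402.12781v2 TeX L1063–1086)] -/
theorem IsTeichmullerLiftOn.exists_smul_eq {Φ : AddSubgroup M}
    {θ : FramedGaloisRep K (padicCoeffIntegers S) 1} (h : IsTeichmullerLiftOn S Φ θ)
    (σ : absoluteGaloisGroup K) :
    ∃ a : ℤ, ‖((entry S θ σ : padicCoeffIntegers S) : PadicAlgCl p) - (a : PadicAlgCl p)‖ < 1 ∧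
      ∀ P ∈ Φ, σ • P = a • P := by
  obtain ⟨a, ha, h'⟩ := h.2 σ
  exact ⟨a, ha, fun P hP ↦ sub_eq_zero.mp ((AddSubgroup.mem_bot).mp (h' P hP))⟩

end Predicates

/-! ## §3 The construction -/

section Construction

variable {p : ℕ} [hp : Fact p.Prime] (S : Set (PadicAlgCl p))

/-- The structure map `ℤ_p → 𝓞 = 𝓞_{ℚ_p(S)} ⊆ ℚ̄_p` (`ℤ_p ⊂ ℚ_p ⊆ ℚ_p(S)`, norm `≤ 1`). [folklore] -/
def padicIntToCoeff : ℤ_[p] →+* padicCoeffIntegers S :=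
  ((algebraMap ℚ_[p] (PadicAlgCl p)).comp PadicInt.Coe.ringHom).codRestrict (padicCoeffIntegers S)
    fun x ↦ ⟨(padicCoeffField S).algebraMap_mem (x : ℚ_[p]), by
      change ‖algebraMap ℚ_[p] (PadicAlgCl p) (x : ℚ_[p])‖ ≤ 1
      rw [norm_algebraMap', ← PadicInt.norm_def]; exact PadicInt.norm_le_one x⟩

/-- `padicIntToCoeff x`, read in `ℚ̄_p`, is the image of `x` under `ℤ_p ⊂ ℚ_p → ℚ̄_p`. [cite: KellerYin2024, §1.1 (arXiv:2402.12781v2 TeX L441: 𝓞-valued Teichmüller lift)] -/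
@[simp]
theorem coe_padicIntToCoeff (x : ℤ_[p]) :
    ((padicIntToCoeff S x : padicCoeffIntegers S) : PadicAlgCl p) =
      algebraMap ℚ_[p] (PadicAlgCl p) (x : ℚ_[p]) :=
  rfl

variable {K : Type} [Field K] {M : Type*} [AddCommGroup M]
  [DistribMulAction (absoluteGaloisGroup K) M] {N T : AddSubgroup M}
  (hN : ∀ g : absoluteGaloisGroup K, ∀ P ∈ N, g • P ∈ N)
  (hT : ∀ g : absoluteGaloisGroup K, ∀ P ∈ T, g • P ∈ T) (hidx : N.relIndex T = p)
  (hfin : (T : Set M).Finite)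
  (hstab : ∀ P ∈ T, IsOpen ((MulAction.stabilizer (absoluteGaloisGroup K) P : Subgroup _) :
    Set (absoluteGaloisGroup K)))

/-- The `𝓞ˣ`-valued Teichmüller character of `Γ_K` on `T/N`, as a bare homomorphism:
`Γ_K → (ℤ/p)ˣ → ℤ_pˣ → 𝓞ˣ` (`quotActionChar`, the tree's `Kato2004.teichmullerChar`, `padicIntToCoeff`).
[cite: KellerYin2024, §1.1 (arXiv:2402.12781v2 TeX L441)] [cite: LangCyclotomic1990, Ch. 1 §2] -/
def teichmullerUnitsChar : absoluteGaloisGroup K →* (padicCoeffIntegers S)ˣ :=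
  (Units.map (padicIntToCoeff S : ℤ_[p] →* padicCoeffIntegers S)).comp
    ((Kato2004.teichmullerChar p).comp (quotActionChar hN hT hidx))

/-- The Teichmüller character is trivial on the pointwise stabiliser of `T`. [cite: KellerYin2024, §1.4 (arXiv:2402.12781v2 TeX L1063–1086)] -/
theorem teichmullerUnitsChar_eq_one_of_forall_smul_eq {σ : absoluteGaloisGroup K}
    (hσ : ∀ P ∈ T, σ • P = P) : teichmullerUnitsChar S hN hT hidx σ = 1 := by
  rw [teichmullerUnitsChar, MonoidHom.comp_apply, MonoidHom.comp_apply,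
    quotActionChar_eq_one_of_forall_smul_eq hN hT hidx hσ, map_one, map_one]

include hfin hstab in
/-- **Continuity**: the Teichmüller character is locally constant — it is trivial on the open
subgroup `⋂_{P ∈ T} Stab(P)` (finitely many points, each with open stabiliser). [cite: KellerYin2024, §1.1 (arXiv:2402.12781v2 TeX L438–441: the continuous character θ)] -/
theorem continuous_teichmullerUnitsChar : Continuous (teichmullerUnitsChar S hN hT hidx) := by
  apply continuous_of_continuousAt_one
  rw [ContinuousAt, map_one]
  intro A hA
  -- the open subgroup fixing `T` pointwise maps to `1 ∈ A`
  have hU : IsOpen (⋂ P ∈ (T : Set M), ((MulAction.stabilizer (absoluteGaloisGroup K) P :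
      Subgroup _) : Set (absoluteGaloisGroup K))) :=
    hfin.isOpen_biInter fun P hP ↦ hstab P hP
  refine Filter.mem_map.mpr (Filter.mem_of_superset (hU.mem_nhds ?_) fun σ hσ ↦ ?_)
  · simp only [Set.mem_iInter, SetLike.mem_coe, MulAction.mem_stabilizer_iff]
    intro P _; exact one_smul _ P
  · simp only [Set.mem_iInter, SetLike.mem_coe, MulAction.mem_stabilizer_iff] at hσ
    rw [Set.mem_preimage, teichmullerUnitsChar_eq_one_of_forall_smul_eq S hN hT hidx hσ]
    exact mem_of_mem_nhds hA

/-- **THE CONSTRUCTION `ω̃` / `𝟙̃`**: the Teichmüller lift of the character of `Γ_K` on the stable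
cyclic subquotient `T/N` of order `p`, as a rank-one framed Galois representation
`Γ_K →ₜ* GL₁(𝓞)`, `𝓞 = 𝓞_{ℚ_p(S)}` (so that `charModule S θ = (F/𝓞)(θ)` of `CharacterSelmerGroups.lean`
is Keller–Yin's `M_θ[γ − 1]`-layer). Data: `N ≤ T` stable under `Γ_K`, `[T : N] = p`, `T` finite with
open stabilisers (for `T = E[p]`: `WeierstrassCurve.isOpen_stabilizer_point_holds`).
[cite: KellerYin2024, §1.4 (arXiv:2402.12781v2 TeX L1063–1086) and §1.1 (L441)] [cite: LangCyclotomic1990, Ch. 1 §2] -/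
def teichmullerLiftOnQuot : FramedGaloisRep K (padicCoeffIntegers S) 1 :=
  (FramedRep.unitsContinuousMulEquivOfUnique (Fin 1) (padicCoeffIntegers S) :
      (padicCoeffIntegers S)ˣ →ₜ* GL (Fin 1) (padicCoeffIntegers S)).comp
    { toMonoidHom := teichmullerUnitsChar S hN hT hidx
      continuous_toFun := continuous_teichmullerUnitsChar S hN hT hidx hfin hstab }

/-- The value of the construction at `σ` is the `1 × 1` matrix `(ω(a(σ)))`. [cite: KellerYin2024, §1.1 (arXiv:2402.12781v2 TeX L441)] -/
theorem teichmullerLiftOnQuot_apply (σ : absoluteGaloisGroup K) :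
    teichmullerLiftOnQuot S hN hT hidx hfin hstab σ =
      FramedRep.unitsContinuousMulEquivOfUnique (Fin 1) (padicCoeffIntegers S)
        (teichmullerUnitsChar S hN hT hidx σ) :=
  rfl

/-- Its entry is `ω(a(σ)) ∈ ℤ_p ⊂ 𝓞`. [cite: KellerYin2024, §1.1 (arXiv:2402.12781v2 TeX L441)] -/
theorem entry_teichmullerLiftOnQuot (σ : absoluteGaloisGroup K) :
    entry S (teichmullerLiftOnQuot S hN hT hidx hfin hstab) σ =
      padicIntToCoeff S ((Kato2004.teichmullerChar p (quotActionChar hN hT hidx σ) : ℤ_[p]ˣ) : ℤ_[p]) := by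
  rw [entry, teichmullerLiftOnQuot_apply, FramedRep.unitsContinuousMulEquivOfUnique_apply_coe]
  rfl

/-- `‖ω(a) − ã‖ < 1` in `ℤ_p` for the canonical integer lift `ã = a.val` of `a ∈ (ℤ/p)ˣ`
(`ω(a) ≡ a (mod p)`, tree theorem `Kato2004.toZMod_teichmullerChar`). [cite: LangCyclotomic1990, Ch. 1 §2] -/
theorem norm_teichmullerChar_sub_val_lt_one (a : (ZMod p)ˣ) :
    ‖((Kato2004.teichmullerChar p a : ℤ_[p]ˣ) : ℤ_[p]) - (((a : ZMod p).val : ℕ) : ℤ_[p])‖ < 1 := by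
  rw [← PadicInt.mem_nonunits, ← IsLocalRing.mem_maximalIdeal, ← PadicInt.ker_toZMod,
    RingHom.mem_ker, map_sub, Kato2004.toZMod_teichmullerChar, map_natCast, ZMod.natCast_zmod_val,
    sub_self]

/-- **SPECIFICATION**: the construction IS the Teichmüller lift of the action on `T/N`.
[cite: KellerYin2024, §1.4 (arXiv:2402.12781v2 TeX L1063–1086) and §1.1 (L441)] -/
theorem isTeichmullerLiftOnQuot_teichmullerLiftOnQuot :
    IsTeichmullerLiftOnQuot S N T (teichmullerLiftOnQuot S hN hT hidx hfin hstab) := by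
  refine ⟨fun σ ↦ ?_, fun σ ↦ ?_⟩
  · have h1 : teichmullerUnitsChar S hN hT hidx σ ^ (p - 1) = 1 := by
      rw [teichmullerUnitsChar, MonoidHom.comp_apply, MonoidHom.comp_apply, ← map_pow,
        Kato2004.teichmullerChar_pow_sub_one, map_one]
    rw [teichmullerLiftOnQuot_apply, ← map_pow, h1, map_one]
  · set a : (ZMod p)ˣ := quotActionChar hN hT hidx σ with ha
    refine ⟨((a : ZMod p).val : ℤ), ?_, fun P hP ↦ smul_sub_zsmul_mem hN hT hidx σ
      (by rw [Int.cast_natCast, ZMod.natCast_zmod_val]) hP⟩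
    rw [entry_teichmullerLiftOnQuot, coe_padicIntToCoeff, ← ha]
    have h := norm_teichmullerChar_sub_val_lt_one (p := p) a
    rw [PadicInt.norm_def, PadicInt.coe_sub, PadicInt.coe_natCast] at h
    rw [Int.cast_natCast, show ((a : ZMod p).val : PadicAlgCl p) =
      algebraMap ℚ_[p] (PadicAlgCl p) ((a : ZMod p).val : ℚ_[p]) by rw [map_natCast], ← map_sub,
      norm_algebraMap']
    exact h

end Construction

/-! ## §4 The `ℚ̄_p`-valued avatar of a rank-one `𝓞`-representation -/

section Avatar

variable {K : Type} [Field K] {p : ℕ} [Fact p.Prime] (S : Set (PadicAlgCl p))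

/-- `𝓞ˣ → ℚ̄_pˣ` as a continuous homomorphism (units of the subring inclusion). [folklore] -/
def unitsCoeffToPadicAlgCl : (padicCoeffIntegers S)ˣ →ₜ* (PadicAlgCl p)ˣ where
  toMonoidHom := Units.map ((padicCoeffIntegers S).subtype : padicCoeffIntegers S →* PadicAlgCl p)
  continuous_toFun := Continuous.units_map _ continuous_subtype_val

/-- Push-forward of `θ : Γ_K → GL₁(𝓞)` along `𝓞 ⊂ ℚ̄_p`: the shape `FramedGaloisRep K ℚ̄_p 1` in
which the tree's `IsPAdicAvatarOf ι φ r` reads a Galois character as the `p`-adic avatar of a Hecke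
character (for `ω̃`, `𝟙̃`: of the finite-order Hecke characters `θ_K` of the Katz frames
`IsKatzLFunction`). [cite: KellerYin2024, §2.1.2 (arXiv:2402.12781v2 TeX L1407–1419: θ_K)] -/
def toPadicAlgCl (θ : FramedGaloisRep K (padicCoeffIntegers S) 1) :
    FramedGaloisRep K (PadicAlgCl p) 1 :=
  (FramedRep.unitsContinuousMulEquivOfUnique (Fin 1) (PadicAlgCl p) :
      (PadicAlgCl p)ˣ →ₜ* GL (Fin 1) (PadicAlgCl p)).comp
    ((unitsCoeffToPadicAlgCl S).comp
      (((FramedRep.unitsContinuousMulEquivOfUnique (Fin 1) (padicCoeffIntegers S)).symm :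
        GL (Fin 1) (padicCoeffIntegers S) →ₜ* (padicCoeffIntegers S)ˣ).comp θ))

/-- The entry of the avatar is the entry of `θ`, read in `ℚ̄_p`. [cite: KellerYin2024, §2.1.2 (arXiv:2402.12781v2 TeX L1407–1419)] -/
theorem toPadicAlgCl_apply_coe (θ : FramedGaloisRep K (padicCoeffIntegers S) 1)
    (σ : absoluteGaloisGroup K) :
    (((toPadicAlgCl S θ σ : GL (Fin 1) (PadicAlgCl p)) : Matrix (Fin 1) (Fin 1) (PadicAlgCl p)) 0 0) =
      ((entry S θ σ : padicCoeffIntegers S) : PadicAlgCl p) := by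
  have h : θ σ = FramedRep.unitsContinuousMulEquivOfUnique (Fin 1) (padicCoeffIntegers S)
      ((FramedRep.unitsContinuousMulEquivOfUnique (Fin 1) (padicCoeffIntegers S)).symm (θ σ)) :=
    ((FramedRep.unitsContinuousMulEquivOfUnique (Fin 1) (padicCoeffIntegers S)).apply_symm_apply _).symm
  conv_rhs => rw [entry, h, FramedRep.unitsContinuousMulEquivOfUnique_apply_coe]
  rfl

end Avatar

end Literature.NumberTheory.EllipticCurves.KellerYin2024

end
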